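import Literature.NumberTheory.Automorphic.ThetaClassSupply
import HarnessLib

/-!
# Theta classes under change of level (W6b-2, level bookkeeping)

Reproduction (Literature): kernel-checked consequences of the definitions of
`Literature.NumberTheory.Automorphic.ThetaClassSupply`; no new axioms, no records.

`WeightForms.thetaClasses ι D Θ ⊆ H` is the set of degree-one classes of ONE quotient (one level) whose
pullback `D.pull` is the archimedean restriction of an adelic form `F ∈ Θ`, holomorphic after restriction.
When the level changes — a second class-map datum `D'` over a second class space `H'` (same adelic group,
same `K`-types and archimedean component, another adelic level `ΓU'` and arithmetic group `Δ'`) and a map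
`f : H → H'` (in the application: pullback of classes along the covering of ball quotients) — a theta class
is carried to a theta class as soon as the two data are COMPATIBLE along `f`:

* `thetaClasses_map_mem_of_restrict_eq` — the general transport, across TWO archimedean restriction
  situations `ι : G₁ →* GU`, `ι' : G₁ →* GU'` with the same component group, compact subgroup and
  classical weight (`G₁, K₁, κ₁, τ₁`; the adelic groups, `K`-types, levels and arithmetic groups may all
  differ): if `f` maps `D.H10` into `D'.H10`, the pullbacks agree as functions on the component group
  (`D'.pull (f c) = D.pull c`, the naturality of the harmonic representative / class lift under the
  covering), holomorphy after restriction is a property of the underlying function, and every `F ∈ Θ`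
  has the RESTRICTION (as a function on `G₁`) of some `F' ∈ Θ'`, then `f` carries `thetaClasses ι D Θ`
  into `thetaClasses ι' D' Θ'` (used with `f := id` to compare theta classes cut from different adelic
  `K`-type situations at one level);
* `thetaClasses_map_mem` — one restriction situation, two levels: the same with the hypothesis on `Θ`
  stated on underlying adelic functions (`F' = F` on `GU`);
* `thetaClasses_map_mem_of_le` — the standard case `ΓU' ≤ ΓU` with `Θ` carried into `Θ'` by the inclusion
  `weightForms ΓU κ τ ≤ weightForms ΓU' κ τ` (`WeightForms.mono_left`);
* `thetaClasses_image_subset` — the same as an inclusion of images.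

This is the bookkeeping behind "theta one-form sets are saturated under pullback by the level coverings"
(the `saturate` clause of the theta/ball dictionary): it reduces that clause to the naturality of the class
lift and the level-monotonicity of the spaces of adelic theta forms. Everything is linear-algebra
bookkeeping [folklore].
-/

open Function

namespace Literature.NumberTheory.Automorphic.WeightForms

variable {GU : Type*} [Group GU] {G₁ : Type*} [Group G₁]
variable {Kc : Type*} [Group Kc] {K₁ : Type*} [Group K₁]
variable {W : Type*} [AddCommGroup W] [Module ℂ W]
variable {ΓU ΓU' : Subgroup GU} {κ : Kc →* GU} {τ : Representation ℂ Kc W}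
variable (ι : G₁ →* GU) {Δ Δ' : Subgroup G₁} {κ₁ : K₁ →* G₁} {τ₁ : Representation ℂ K₁ W}
variable {hΔ : IsLevelCorrected ΓU κ τ ι Δ} {hΔ' : IsLevelCorrected ΓU' κ τ ι Δ'} {η₁ : K₁ →* Kc}
  {hη : IsWeightMatched κ τ ι κ₁ τ₁ η₁}
variable {H : Type*} [AddCommGroup H] [Module ℂ H] {H' : Type*} [AddCommGroup H'] [Module ℂ H']

/-- The archimedean restriction only sees the underlying adelic function: two forms of (possibly different)
levels with the same underlying function have restrictions with the same underlying function. [folklore] -/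
theorem coe_restrictHom_eq_of_coe_eq {F : weightForms ΓU κ τ} {F' : weightForms ΓU' κ τ}
    (h : (F' : GU → W) = F) :
    (restrictHom ι hΔ' hη F' : G₁ → W) = (restrictHom ι hΔ hη F : G₁ → W) := by
  funext x
  rw [restrictHom_apply, restrictHom_apply, h]

/-- **Transport of theta classes across two restriction situations.** Let `ι : G₁ →* GU` and
`ι' : G₁ →* GU'` be two archimedean restriction situations with the same component group `G₁`, compact
subgroup `κ₁ : K₁ →* G₁` and classical weight `τ₁` (adelic groups `GU, GU'`, `K`-types `(Kc, κ, τ)`,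
`(Kc', κ', τ')`, levels `ΓU, ΓU'`, arithmetic groups `Δ, Δ'` arbitrary), `D`, `D'` class-map data over
class spaces `H`, `H'`, and `f : H → H'`. Assume: `f` maps `(1,0)`-classes to `(1,0)`-classes (`hf10`);
the pullbacks are compatible along `f` as functions on `G₁` (`hpull` — naturality of the class lift);
holomorphy after restriction depends only on the underlying function on `G₁` (`hHol`); and every form of
`Θ` restricts (on `G₁`) to the restriction of a form of `Θ'` (`hΘ`). Then `f` carries theta classes of
`(D, Θ)` to theta classes of `(D', Θ')`. [folklore] -/
theorem thetaClasses_map_mem_of_restrict_eq {GU' : Type*} [Group GU'] {Kc' : Type*} [Group Kc']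
    {ΓU'' : Subgroup GU'} {κ' : Kc' →* GU'} {τ' : Representation ℂ Kc' W} (ι' : G₁ →* GU')
    {hΔ'' : IsLevelCorrected ΓU'' κ' τ' ι' Δ'} {η₁' : K₁ →* Kc'} {hη' : IsWeightMatched κ' τ' ι' κ₁ τ₁ η₁'}
    (D : ClassMapDatum ι hΔ hη H) (D' : ClassMapDatum ι' hΔ'' hη' H') (f : H → H')
    (hf10 : ∀ c ∈ D.H10, f c ∈ D'.H10)
    (hpull : ∀ c : D.H10, ((D'.pull ⟨f c, hf10 c c.2⟩ : weightForms Δ' κ₁ τ₁) : G₁ → W) =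
      ((D.pull c : weightForms Δ κ₁ τ₁) : G₁ → W))
    (hHol : ∀ g ∈ D.Hol, ∀ g' : weightForms Δ' κ₁ τ₁, (g' : G₁ → W) = (g : G₁ → W) → g' ∈ D'.Hol)
    {Θ : Submodule ℂ (weightForms ΓU κ τ)} {Θ' : Submodule ℂ (weightForms ΓU'' κ' τ')}
    (hΘ : ∀ F ∈ Θ, ∃ F' ∈ Θ',
      (restrictHom ι' hΔ'' hη' F' : G₁ → W) = (restrictHom ι hΔ hη F : G₁ → W))
    {h : H} (hh : h ∈ thetaClasses ι D Θ) : f h ∈ thetaClasses ι' D' Θ' := by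
  obtain ⟨c, rfl, F, hF, hFhol, hc⟩ := hh
  obtain ⟨F', hF', hres⟩ := hΘ F hF
  refine ⟨⟨f c, hf10 c c.2⟩, rfl, F', hF', hHol _ hFhol _ hres, ?_⟩
  apply Subtype.ext
  rw [hpull c, hc, hres]

/-- **Theta classes under change of level.** One restriction situation `ι : G₁ →* GU`, two levels: `D`,
`D'` class-map data over class spaces `H`, `H'` (levels `ΓU, Δ` and `ΓU', Δ'`) and `f : H → H'`. Assume:
`f` maps `(1,0)`-classes to `(1,0)`-classes (`hf10`); the pullbacks are compatible along `f` as functions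
on the component group (`hpull` — naturality of the class lift under the covering); holomorphy after
restriction depends only on the underlying function (`hHol`); and every adelic form of `Θ` has the
underlying function of a form of `Θ'` (`hΘ` — level-monotonicity of the theta forms). Then `f` carries
theta classes of `(D, Θ)` to theta classes of `(D', Θ')`. [folklore] -/
theorem thetaClasses_map_mem (D : ClassMapDatum ι hΔ hη H) (D' : ClassMapDatum ι hΔ' hη H') (f : H → H')
    (hf10 : ∀ c ∈ D.H10, f c ∈ D'.H10)
    (hpull : ∀ c : D.H10, ((D'.pull ⟨f c, hf10 c c.2⟩ : weightForms Δ' κ₁ τ₁) : G₁ → W) =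
      ((D.pull c : weightForms Δ κ₁ τ₁) : G₁ → W))
    (hHol : ∀ g ∈ D.Hol, ∀ g' : weightForms Δ' κ₁ τ₁, (g' : G₁ → W) = (g : G₁ → W) → g' ∈ D'.Hol)
    {Θ : Submodule ℂ (weightForms ΓU κ τ)} {Θ' : Submodule ℂ (weightForms ΓU' κ τ)}
    (hΘ : ∀ F ∈ Θ, ∃ F' ∈ Θ', (F' : GU → W) = F)
    {h : H} (hh : h ∈ thetaClasses ι D Θ) : f h ∈ thetaClasses ι D' Θ' :=
  thetaClasses_map_mem_of_restrict_eq ι ι D D' f hf10 hpull hHol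
    (fun F hF => by
      obtain ⟨F', hF', hFF'⟩ := hΘ F hF
      exact ⟨F', hF', coe_restrictHom_eq_of_coe_eq ι hFF'⟩) hh

/-- **Theta classes under change of level, standard case**: the finer adelic level `ΓU' ≤ ΓU`, the theta
forms of level `ΓU` contained in those of level `ΓU'` through the inclusion of weight forms
(`WeightForms.mono_left`). [folklore] -/
theorem thetaClasses_map_mem_of_le (D : ClassMapDatum ι hΔ hη H) (D' : ClassMapDatum ι hΔ' hη H')
    (f : H → H') (hf10 : ∀ c ∈ D.H10, f c ∈ D'.H10)
    (hpull : ∀ c : D.H10, ((D'.pull ⟨f c, hf10 c c.2⟩ : weightForms Δ' κ₁ τ₁) : G₁ → W) =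
      ((D.pull c : weightForms Δ κ₁ τ₁) : G₁ → W))
    (hHol : ∀ g ∈ D.Hol, ∀ g' : weightForms Δ' κ₁ τ₁, (g' : G₁ → W) = (g : G₁ → W) → g' ∈ D'.Hol)
    (hle : ΓU' ≤ ΓU) {Θ : Submodule ℂ (weightForms ΓU κ τ)} {Θ' : Submodule ℂ (weightForms ΓU' κ τ)}
    (hΘ : ∀ F ∈ Θ, (⟨(F : GU → W), mono_left hle F.2⟩ : weightForms ΓU' κ τ) ∈ Θ')
    {h : H} (hh : h ∈ thetaClasses ι D Θ) : f h ∈ thetaClasses ι D' Θ' :=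
  thetaClasses_map_mem ι D D' f hf10 hpull hHol (fun F hF => ⟨_, hΘ F hF, rfl⟩) hh

/-- The change of level as an inclusion of images. [folklore] -/
theorem thetaClasses_image_subset (D : ClassMapDatum ι hΔ hη H) (D' : ClassMapDatum ι hΔ' hη H')
    (f : H → H') (hf10 : ∀ c ∈ D.H10, f c ∈ D'.H10)
    (hpull : ∀ c : D.H10, ((D'.pull ⟨f c, hf10 c c.2⟩ : weightForms Δ' κ₁ τ₁) : G₁ → W) =
      ((D.pull c : weightForms Δ κ₁ τ₁) : G₁ → W))
    (hHol : ∀ g ∈ D.Hol, ∀ g' : weightForms Δ' κ₁ τ₁, (g' : G₁ → W) = (g : G₁ → W) → g' ∈ D'.Hol)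
    {Θ : Submodule ℂ (weightForms ΓU κ τ)} {Θ' : Submodule ℂ (weightForms ΓU' κ τ)}
    (hΘ : ∀ F ∈ Θ, ∃ F' ∈ Θ', (F' : GU → W) = F) :
    f '' thetaClasses ι D Θ ⊆ thetaClasses ι D' Θ' := by
  rintro _ ⟨h, hh, rfl⟩
  exact thetaClasses_map_mem ι D D' f hf10 hpull hHol hΘ hh

/-- **Holomorphy transported along equal functions is automatic when `Hol` is cut out by a predicate on the
underlying function** — the shape in which the geometric side defines `Hol` (holomorphic after descent to
the ball); recorded so that the hypothesis `hHol` of `thetaClasses_map_mem` is discharged by `rfl`-level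
bookkeeping there. [folklore] -/
theorem hol_transport_of_predicate {P : (G₁ → W) → Prop} (Hol : Submodule ℂ (weightForms Δ κ₁ τ₁))
    (Hol' : Submodule ℂ (weightForms Δ' κ₁ τ₁)) (hP : ∀ g : weightForms Δ κ₁ τ₁, g ∈ Hol → P g)
    (hP' : ∀ g' : weightForms Δ' κ₁ τ₁, P g' → g' ∈ Hol') :
    ∀ g ∈ Hol, ∀ g' : weightForms Δ' κ₁ τ₁, (g' : G₁ → W) = (g : G₁ → W) → g' ∈ Hol' := by
  intro g hg g' hgg'
  exact hP' g' (hgg' ▸ hP g hg)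

end Literature.NumberTheory.Automorphic.WeightForms
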